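import Summits.HodgeConjecture.HodgeConjecture.Theorems.EightfoldBlochSeedsChernCharacterOnBettiAnalytificationCharacter
import Literature.AlgebraicGeometry.HodgeTheory.SectionFramesOfTrivialisations
import Literature.AlgebraicGeometry.Modules.PullbackFrame
import HarnessLib

/-!
# K1 (analytification bridge), step K1e: analytification commutes with pull-back — `(f^*F)(ℂ) ≅ f(ℂ)^*(F(ℂ))`

Route `EightfoldBlochSeeds` / item `stmt-HodgeConjecture-19780` (`ChernCharacterOnBetti`), helper
(`--supports`). HONEST FRAMING: nothing here proves 19780 / 18880 / 18882 / 18883 / H2 / HC_AV / HC;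
no definition, no named fact.

WHAT. For a `ℂ`-morphism `g : Y ⟶ X`, an `𝒪_X`-module `F` with trivialisations `𝒪^r ≅ F|_U` near every
point, a topological comparison datum `(E, α)` of `F` on `X(ℂ)` and a datum `(E', α')` of the module
pull-back `g^*F = (Scheme.Modules.pullback g).obj F` on `Y(ℂ)` (steps 2–4), the pulled-back bundle
`g(ℂ)^*E` is isomorphic to `E'`, compatibly with the pull-back of sections
`η : Γ(F, U) → Γ(g^*F, g⁻¹U)` (tree: `Modules/PullbackUnitSections`, `Modules/PullbackFrame`): Serre,
GAGA §3 n°9–11 (functoriality of `F ↦ F^h`), Hartshorne II.5 p. 110 (`f^*` of a locally free sheaf is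
locally free on the pulled-back frames). Steps:

* `isSectionFrame_unitSection` — pulled-back basis sections `η(b_i)` of a trivialisation are a frame
  of `g^*F` over `g⁻¹U` (`pullbackFrame`, `isSectionFrame_basisSection`);
* `comparison_pullback_eq_of_frame` — a fibre map `E_{g(Q)} → E'_Q` carrying `α(b_k)(g Q)` to
  `α'(η b_k)(Q)` on ONE frame does so on every section (expand in the frame; `η` is `g^♯`-semilinear,
  `AlgPoints.eval_map`); `linearMap_eq_of_comparison_pullback` — hence such fibre maps are unique;
* **`exists_iso_pullback_of_comparison`** — `∃ e : (E.pullback g(ℂ)).Iso E'` with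
  `e(α_U(σ)(g Q)) = α'_{g⁻¹U}(η σ)(Q)` (local frame isomorphisms glued, as in K1b);
* (sequel `…AnalytificationPullbackChern`: the Betti Chern classes / character of `g^*F` are the
  pull-backs `g(ℂ)^*` of those of `F` — field `map_ch` of `ChernCharacterBetti`.)

[cite: SerreGAGA1956, §3 n°9 Déf. 2, Prop. 10 and n°11] [cite: Hartshorne1977, II.5 (p. 110)]
[cite: HusemollerFibreBundles1994, Ch. 17 §3 (C₁)]
-/

noncomputable section

-- single-problem summit (Problem = Summit): the mandated namespace repeats `HodgeConjecture`.
set_option linter.dupNamespace false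

open CategoryTheory AlgebraicGeometry Bundle Topology TopologicalSpace
open Literature.AlgebraicGeometry.Motives Literature.AlgebraicGeometry.HodgeTheory Literature.AlgebraicGeometry.Modules
open Literature.AlgebraicTopology.SingularHomology Literature.AlgebraicTopology.CharacteristicClasses

namespace Summit.HodgeConjecture.HodgeConjecture.Theorems

variable {n m : ℕ} {X Y : SchemeOver ℂ} (g : Y ⟶ X) {F : X.left.Modules} {r : ℕ}

/-- **Pulled-back basis sections are a frame of `g^*F`**: for a trivialisation `e : 𝒪^I ≅ F|_U` and an
enumeration `I ≃ Fin r`, the sections `η(b_i) ∈ Γ(g^*F, g⁻¹U)` form an `IsSectionFrame` over `g⁻¹U`.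
[cite: Hartshorne1977, II.5 (p. 110)] -/
theorem isSectionFrame_unitSection {U : X.left.Opens} {I : Type} (e : SheafOfModules.free I ≅ F.over U)
    (ε : I ≃ Fin r) :
    IsSectionFrame ((Scheme.Modules.pullback g.left).obj F) (g.left ⁻¹ᵁ U)
      (fun k ↦ unitSection g.left F U (basisSection e (ε.symm k))) := by
  haveI : Fintype I := Fintype.ofEquiv _ ε.symm
  have h := isSectionFrame_basisSection (E := (Scheme.Modules.pullback g.left).obj F) (pullbackFrame g.left e) ε
  simp only [basisSection_pullbackFrame] at h
  exact h

variable {V : ComplexPoints X → Type*} [∀ P, AddCommGroup (V P)] [∀ P, Module ℂ (V P)]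
  {W : ComplexPoints Y → Type*} [∀ Q, AddCommGroup (W Q)] [∀ Q, Module ℂ (W Q)]

/-- **A fibre map `V_{g(Q)} → W_Q` carrying `α` to `α' ∘ η` on ONE frame at `g(Q)` does so on every
section.** Here `α` is an additive, `𝒪_X`-linear, restriction-compatible comparison map for `F` (into
fibres `V` over `X(ℂ)`), `α'` one for `g^*F` (into fibres `W` over `Y(ℂ)`), `s` a frame of `F` over
`U ∋ g(Q)`: expand `σ|_{U' ∩ U} = Σ c_k s_k`; then `η(σ)| = Σ g^♯(c_k) η(s_k)|` and
`c_k(g(Q)) = g^♯(c_k)(Q)`. [cite: SerreGAGA1956, §3 n°9 Déf. 2 and n°11] -/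
theorem comparison_pullback_eq_of_frame
    (α : ∀ U : X.left.Opens, Γ(F, U) → ∀ P : ComplexPoints X, V P)
    (β : ∀ U' : Y.left.Opens, Γ((Scheme.Modules.pullback g.left).obj F, U') → ∀ Q : ComplexPoints Y, W Q)
    (hadd : ∀ (U : X.left.Opens) (σ τ : Γ(F, U)) (P : ComplexPoints X), α U (σ + τ) P = α U σ P + α U τ P)
    (hsmul : ∀ (U : X.left.Opens) (f : Γ(X.left, U)) (σ : Γ(F, U)) (P : ComplexPoints X) (h : P.pt ∈ U),
      α U (f • σ) P = P.eval U h f • α U σ P)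
    (hres : ∀ (U W : X.left.Opens) (hWU : W ≤ U) (σ : Γ(F, U)) (P : ComplexPoints X), P.pt ∈ W →
      α W (F.presheaf.map (homOfLE hWU).op σ) P = α U σ P)
    (hadd' : ∀ (U : Y.left.Opens) (σ τ : Γ((Scheme.Modules.pullback g.left).obj F, U)) (Q : ComplexPoints Y),
      β U (σ + τ) Q = β U σ Q + β U τ Q)
    (hsmul' : ∀ (U : Y.left.Opens) (f : Γ(Y.left, U)) (σ : Γ((Scheme.Modules.pullback g.left).obj F, U))
      (Q : ComplexPoints Y) (h : Q.pt ∈ U), β U (f • σ) Q = Q.eval U h f • β U σ Q)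
    (hres' : ∀ (U W : Y.left.Opens) (hWU : W ≤ U) (σ : Γ((Scheme.Modules.pullback g.left).obj F, U))
      (Q : ComplexPoints Y), Q.pt ∈ W →
      β W (((Scheme.Modules.pullback g.left).obj F).presheaf.map (homOfLE hWU).op σ) Q = β U σ Q)
    {U : X.left.Opens} {s : Fin r → Γ(F, U)} (hs : IsSectionFrame F U s) {Q : ComplexPoints Y}
    (h : (AlgPoints.map g Q).pt ∈ U) (Φ : V (AlgPoints.map g Q) →ₗ[ℂ] W Q)
    (hΦ : ∀ k, Φ (α U (s k) (AlgPoints.map g Q)) = β (g.left ⁻¹ᵁ U) (unitSection g.left F U (s k)) Q)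
    {U' : X.left.Opens} (σ : Γ(F, U')) (h' : (AlgPoints.map g Q).pt ∈ U') :
    Φ (α U' σ (AlgPoints.map g Q)) = β (g.left ⁻¹ᵁ U') (unitSection g.left F U' σ) Q := by
  set P := AlgPoints.map g Q with hPdef
  have hP : P.pt ∈ U' ⊓ U := ⟨h', h⟩
  have hQ : Q.pt ∈ g.left ⁻¹ᵁ (U' ⊓ U) := hP
  -- expand `σ|_{U' ∩ U}` in the frame
  set b := (hs.of_le (inf_le_right : U' ⊓ U ≤ U)).basis with hb
  rw [comparison_expand α hadd hsmul hres hs σ h' h, map_sum]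
  -- the right-hand side: restrict to `g⁻¹(U' ∩ U)`, pull back the expansion
  rw [← hres' (g.left ⁻¹ᵁ U') (g.left ⁻¹ᵁ (U' ⊓ U)) (fun x hx ↦ (inf_le_left : U' ⊓ U ≤ U') hx) _ Q hQ]
  have hmap : ((Scheme.Modules.pullback g.left).obj F).presheaf.map
      (homOfLE (fun x hx ↦ (inf_le_left : U' ⊓ U ≤ U') hx) : g.left ⁻¹ᵁ (U' ⊓ U) ⟶ g.left ⁻¹ᵁ U').op
        (unitSection g.left F U' σ) =
      unitSection g.left F (U' ⊓ U) (F.presheaf.map (homOfLE inf_le_left).op σ) := by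
    rw [unitSection_map]
    rfl
  rw [hmap]
  conv_rhs => rw [← b.sum_repr (F.presheaf.map (homOfLE inf_le_left).op σ)]
  rw [unitSection_sum, comparison_sum β hadd']
  refine Finset.sum_congr rfl fun k _ ↦ ?_
  rw [map_smul, hΦ k, unitSection_smul, hsmul' _ _ _ Q hQ, AlgPoints.evalOrZero_of_mem _ hP,
    AlgPoints.eval_map g Q (U' ⊓ U) hP, hb, IsSectionFrame.basis_apply]
  congr 1
  -- `β(η(s_k|))(Q) = β(η(s_k))(Q)`
  have hk : unitSection g.left F (U' ⊓ U) (F.presheaf.map (homOfLE (inf_le_right : U' ⊓ U ≤ U)).op (s k)) =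
      ((Scheme.Modules.pullback g.left).obj F).presheaf.map
        (homOfLE (fun x hx ↦ (inf_le_right : U' ⊓ U ≤ U) hx) : g.left ⁻¹ᵁ (U' ⊓ U) ⟶ g.left ⁻¹ᵁ U).op
        (unitSection g.left F U (s k)) := by
    rw [unitSection_map]
    rfl
  rw [hk, hres' _ _ _ _ Q hQ]

/-- **Uniqueness of the fibre comparison across the pull-back**: two `ℂ`-linear maps
`E_{g(Q)} → E'_Q` each carrying `α` to `α' ∘ η` on SOME frame of `F` at `g(Q)` are equal.
[cite: SerreGAGA1956, §3 n°9 Prop. 10 and n°11] -/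
theorem linearMap_eq_of_comparison_pullback {E : ComplexVectorBundle.{0, 0} (ComplexPoints X)}
    {E' : ComplexVectorBundle.{0, 0} (ComplexPoints Y)}
    (α : ∀ U : X.left.Opens, Γ(F, U) → ∀ P : ComplexPoints X, E.E P)
    (β : ∀ U' : Y.left.Opens, Γ((Scheme.Modules.pullback g.left).obj F, U') → ∀ Q : ComplexPoints Y, E'.E Q)
    (hadd : ∀ (U : X.left.Opens) (σ τ : Γ(F, U)) (P : ComplexPoints X), α U (σ + τ) P = α U σ P + α U τ P)
    (hsmul : ∀ (U : X.left.Opens) (f : Γ(X.left, U)) (σ : Γ(F, U)) (P : ComplexPoints X) (h : P.pt ∈ U),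
      α U (f • σ) P = P.eval U h f • α U σ P)
    (hres : ∀ (U W : X.left.Opens) (hWU : W ≤ U) (σ : Γ(F, U)) (P : ComplexPoints X), P.pt ∈ W →
      α W (F.presheaf.map (homOfLE hWU).op σ) P = α U σ P)
    (hframe : ∀ (U : X.left.Opens) (t : Fin r → Γ(F, U)), IsSectionFrame F U t →
      ∀ P : ComplexPoints X, P.pt ∈ U → LinearIndependent ℂ (fun j ↦ α U (t j) P) ∧
        ⊤ ≤ Submodule.span ℂ (Set.range fun j ↦ α U (t j) P))
    (hadd' : ∀ (U : Y.left.Opens) (σ τ : Γ((Scheme.Modules.pullback g.left).obj F, U)) (Q : ComplexPoints Y),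
      β U (σ + τ) Q = β U σ Q + β U τ Q)
    (hsmul' : ∀ (U : Y.left.Opens) (f : Γ(Y.left, U)) (σ : Γ((Scheme.Modules.pullback g.left).obj F, U))
      (Q : ComplexPoints Y) (h : Q.pt ∈ U), β U (f • σ) Q = Q.eval U h f • β U σ Q)
    (hres' : ∀ (U W : Y.left.Opens) (hWU : W ≤ U) (σ : Γ((Scheme.Modules.pullback g.left).obj F, U))
      (Q : ComplexPoints Y), Q.pt ∈ W →
      β W (((Scheme.Modules.pullback g.left).obj F).presheaf.map (homOfLE hWU).op σ) Q = β U σ Q)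
    {Q : ComplexPoints Y} {U₁ U₂ : X.left.Opens} {t₁ : Fin r → Γ(F, U₁)} {t₂ : Fin r → Γ(F, U₂)}
    (ht₁ : IsSectionFrame F U₁ t₁) (ht₂ : IsSectionFrame F U₂ t₂) (h₁ : (AlgPoints.map g Q).pt ∈ U₁)
    (h₂ : (AlgPoints.map g Q).pt ∈ U₂) (Φ Ψ : E.E (AlgPoints.map g Q) →ₗ[ℂ] E'.E Q)
    (hΦ : ∀ k, Φ (α U₁ (t₁ k) (AlgPoints.map g Q)) = β (g.left ⁻¹ᵁ U₁) (unitSection g.left F U₁ (t₁ k)) Q)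
    (hΨ : ∀ k, Ψ (α U₂ (t₂ k) (AlgPoints.map g Q)) = β (g.left ⁻¹ᵁ U₂) (unitSection g.left F U₂ (t₂ k)) Q) :
    Φ = Ψ := by
  letI : ∀ P : ComplexPoints X, AddCommGroup (E.E P) := fun P ↦ Module.addCommMonoidToAddCommGroup ℂ
  letI : ∀ Q : ComplexPoints Y, AddCommGroup (E'.E Q) := fun Q ↦ Module.addCommMonoidToAddCommGroup ℂ
  refine (Module.Basis.mk (hframe U₁ t₁ ht₁ _ h₁).1 (hframe U₁ t₁ ht₁ _ h₁).2).ext fun k ↦ ?_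
  rw [Module.Basis.mk_apply, hΦ k]
  exact (comparison_pullback_eq_of_frame g α β hadd hsmul hres hadd' hsmul' hres' ht₂ h₂ Ψ hΨ (t₁ k) h₁).symm

/-- **Local frame isomorphism across the pull-back**: over `g⁻¹U(ℂ)`, for a trivialisation
`e : 𝒪^r ≅ F|_U`, the bundles `g(ℂ)^*E` and `E'` are framed by `Q ↦ α(b_k)(g Q)` and `Q ↦ α'(η b_k)(Q)`,
hence isomorphic by an isomorphism matching these frames. [cite: MilnorStasheff1974, §2 Thm. 2.2 and Lemma 2.3]
[cite: Hartshorne1977, II.5 (p. 110)] -/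
theorem exists_local_iso_pullback_of_comparison (E : ComplexVectorBundle.{0, 0} (ComplexPoints X))
    (E' : ComplexVectorBundle.{0, 0} (ComplexPoints Y))
    (α : ∀ U : X.left.Opens, Γ(F, U) → ∀ P : ComplexPoints X, E.E P)
    (β : ∀ U' : Y.left.Opens, Γ((Scheme.Modules.pullback g.left).obj F, U') → ∀ Q : ComplexPoints Y, E'.E Q)
    (hcont : ∀ (U : X.left.Opens) (σ : Γ(F, U)),
      ContinuousOn (fun P ↦ (⟨P, α U σ P⟩ : TotalSpace E.F E.E)) {P | P.pt ∈ U})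
    (hframe : ∀ (U : X.left.Opens) (t : Fin r → Γ(F, U)), IsSectionFrame F U t →
      ∀ P : ComplexPoints X, P.pt ∈ U → LinearIndependent ℂ (fun j ↦ α U (t j) P) ∧
        ⊤ ≤ Submodule.span ℂ (Set.range fun j ↦ α U (t j) P))
    (hcont' : ∀ (U : Y.left.Opens) (σ : Γ((Scheme.Modules.pullback g.left).obj F, U)),
      ContinuousOn (fun Q ↦ (⟨Q, β U σ Q⟩ : TotalSpace E'.F E'.E)) {Q | Q.pt ∈ U})
    (hframe' : ∀ (U : Y.left.Opens) (t : Fin r → Γ((Scheme.Modules.pullback g.left).obj F, U)),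
      IsSectionFrame ((Scheme.Modules.pullback g.left).obj F) U t →
      ∀ Q : ComplexPoints Y, Q.pt ∈ U → LinearIndependent ℂ (fun j ↦ β U (t j) Q) ∧
        ⊤ ≤ Submodule.span ℂ (Set.range fun j ↦ β U (t j) Q))
    {U : X.left.Opens} (e : SheafOfModules.free (Fin r) ≅ F.over U) :
    ∃ i : ((E.pullback (AlgPoints.mapContinuous g)).pullback
        (⟨Subtype.val, continuous_subtype_val⟩ :
          C(complexPointsCompl Y (((g.left ⁻¹ᵁ U : Y.left.Opens) : Set Y.left)ᶜ), ComplexPoints Y))).Iso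
      (E'.pullback (⟨Subtype.val, continuous_subtype_val⟩ :
          C(complexPointsCompl Y (((g.left ⁻¹ᵁ U : Y.left.Opens) : Set Y.left)ᶜ), ComplexPoints Y))),
      ∀ (Q : complexPointsCompl Y (((g.left ⁻¹ᵁ U : Y.left.Opens) : Set Y.left)ᶜ)) (k : Fin r),
        i.equiv Q (α U (basisSection e k) (AlgPoints.map g Q.1)) =
          β (g.left ⁻¹ᵁ U) (unitSection g.left F U (basisSection e k)) Q.1 := by
  have hsX : IsSectionFrame F U (fun k ↦ basisSection e ((Equiv.refl (Fin r)).symm k)) :=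
    isSectionFrame_basisSection e (Equiv.refl _)
  have hsY := isSectionFrame_unitSection g e (Equiv.refl (Fin r))
  have hmem : ∀ Q : complexPointsCompl Y (((g.left ⁻¹ᵁ U : Y.left.Opens) : Set Y.left)ᶜ),
      (AlgPoints.map g Q.1).pt ∈ U := fun Q ↦ Set.notMem_compl_iff.1 Q.2
  refine ComplexVectorBundle.exists_iso_of_frames
    ((E.pullback (AlgPoints.mapContinuous g)).pullback
        (⟨Subtype.val, continuous_subtype_val⟩ :
          C(complexPointsCompl Y (((g.left ⁻¹ᵁ U : Y.left.Opens) : Set Y.left)ᶜ), ComplexPoints Y)))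
    (E'.pullback (⟨Subtype.val, continuous_subtype_val⟩ :
          C(complexPointsCompl Y (((g.left ⁻¹ᵁ U : Y.left.Opens) : Set Y.left)ᶜ), ComplexPoints Y)))
    (fun k (Q : complexPointsCompl Y (((g.left ⁻¹ᵁ U : Y.left.Opens) : Set Y.left)ᶜ)) ↦
      α U (basisSection e k) (AlgPoints.map g Q.1))
    (fun k (Q : complexPointsCompl Y (((g.left ⁻¹ᵁ U : Y.left.Opens) : Set Y.left)ᶜ)) ↦
      β (g.left ⁻¹ᵁ U) (unitSection g.left F U (basisSection e k)) Q.1)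
    (fun k ↦ ?_) (fun Q ↦ ?_) (fun k ↦ ?_) (fun Q ↦ ?_)
  · -- continuity of `Q ↦ α(b_k)(g Q)` into the doubly pulled-back bundle
    refine continuous_section_pullback_of_continuous (X := Y) (E.pullback (AlgPoints.mapContinuous g)) _
      (fun Q ↦ α U (basisSection e k) (AlgPoints.map g Q.1)) ?_
    refine (inducing_pullbackTotalSpaceEmbedding E.F E.E (AlgPoints.mapContinuous g)).continuous_iff.2 ?_
    refine continuous_subtype_val.prodMk ?_
    exact (hcont U (basisSection e k)).comp_continuous
      ((AlgPoints.continuous_map g).comp continuous_subtype_val) fun Q ↦ hmem Q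
  · exact hframe U _ hsX (AlgPoints.map g Q.1) (hmem Q)
  · exact continuous_section_pullback_of_continuous E' _
      (fun Q ↦ β (g.left ⁻¹ᵁ U) (unitSection g.left F U (basisSection e k)) Q.1)
      ((hcont' _ _).comp_continuous continuous_subtype_val fun Q ↦ Set.notMem_compl_iff.1 Q.2)
  · exact hframe' _ _ hsY Q.1 (Set.notMem_compl_iff.1 Q.2)

set_option maxHeartbeats 400000 in
/-- **Analytification commutes with pull-back: `g(ℂ)^*E ≅ E'` compatibly with `η`.** For data
`(E, α)` of `F` (trivialisations `𝒪^r ≅ F|_U` near every point of `X`) and `(E', α')` of `g^*F`, there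
is `i : (E.pullback g(ℂ)) ≅ E'` with `i(α_U(σ)(g Q)) = α'_{g⁻¹U}(η σ)(Q)` whenever `g(Q) ∈ U(ℂ)`.
[cite: SerreGAGA1956, §3 n°9 Déf. 2, Prop. 10 and n°11] [cite: Hartshorne1977, II.5 (p. 110)] -/
theorem exists_iso_pullback_of_comparison
    (hF : ∀ x : X.left, ∃ (U : X.left.Opens) (_ : SheafOfModules.free (Fin r) ≅ F.over U), x ∈ U)
    (E : ComplexVectorBundle.{0, 0} (ComplexPoints X)) (E' : ComplexVectorBundle.{0, 0} (ComplexPoints Y))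
    (α : ∀ U : X.left.Opens, Γ(F, U) → ∀ P : ComplexPoints X, E.E P)
    (β : ∀ U' : Y.left.Opens, Γ((Scheme.Modules.pullback g.left).obj F, U') → ∀ Q : ComplexPoints Y, E'.E Q)
    (hadd : ∀ (U : X.left.Opens) (σ τ : Γ(F, U)) (P : ComplexPoints X), α U (σ + τ) P = α U σ P + α U τ P)
    (hsmul : ∀ (U : X.left.Opens) (f : Γ(X.left, U)) (σ : Γ(F, U)) (P : ComplexPoints X) (h : P.pt ∈ U),
      α U (f • σ) P = P.eval U h f • α U σ P)
    (hres : ∀ (U W : X.left.Opens) (hWU : W ≤ U) (σ : Γ(F, U)) (P : ComplexPoints X), P.pt ∈ W →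
      α W (F.presheaf.map (homOfLE hWU).op σ) P = α U σ P)
    (hcont : ∀ (U : X.left.Opens) (σ : Γ(F, U)),
      ContinuousOn (fun P ↦ (⟨P, α U σ P⟩ : TotalSpace E.F E.E)) {P | P.pt ∈ U})
    (hframe : ∀ (U : X.left.Opens) (t : Fin r → Γ(F, U)), IsSectionFrame F U t →
      ∀ P : ComplexPoints X, P.pt ∈ U → LinearIndependent ℂ (fun j ↦ α U (t j) P) ∧
        ⊤ ≤ Submodule.span ℂ (Set.range fun j ↦ α U (t j) P))
    (hadd' : ∀ (U : Y.left.Opens) (σ τ : Γ((Scheme.Modules.pullback g.left).obj F, U)) (Q : ComplexPoints Y),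
      β U (σ + τ) Q = β U σ Q + β U τ Q)
    (hsmul' : ∀ (U : Y.left.Opens) (f : Γ(Y.left, U)) (σ : Γ((Scheme.Modules.pullback g.left).obj F, U))
      (Q : ComplexPoints Y) (h : Q.pt ∈ U), β U (f • σ) Q = Q.eval U h f • β U σ Q)
    (hres' : ∀ (U W : Y.left.Opens) (hWU : W ≤ U) (σ : Γ((Scheme.Modules.pullback g.left).obj F, U))
      (Q : ComplexPoints Y), Q.pt ∈ W →
      β W (((Scheme.Modules.pullback g.left).obj F).presheaf.map (homOfLE hWU).op σ) Q = β U σ Q)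
    (hcont' : ∀ (U : Y.left.Opens) (σ : Γ((Scheme.Modules.pullback g.left).obj F, U)),
      ContinuousOn (fun Q ↦ (⟨Q, β U σ Q⟩ : TotalSpace E'.F E'.E)) {Q | Q.pt ∈ U})
    (hframe' : ∀ (U : Y.left.Opens) (t : Fin r → Γ((Scheme.Modules.pullback g.left).obj F, U)),
      IsSectionFrame ((Scheme.Modules.pullback g.left).obj F) U t →
      ∀ Q : ComplexPoints Y, Q.pt ∈ U → LinearIndependent ℂ (fun j ↦ β U (t j) Q) ∧
        ⊤ ≤ Submodule.span ℂ (Set.range fun j ↦ β U (t j) Q)) :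
    ∃ i : (E.pullback (AlgPoints.mapContinuous g)).Iso E',
      ∀ (U : X.left.Opens) (σ : Γ(F, U)) (Q : ComplexPoints Y), (AlgPoints.map g Q).pt ∈ U →
        i.equiv Q (α U σ (AlgPoints.map g Q)) = β (g.left ⁻¹ᵁ U) (unitSection g.left F U σ) Q := by
  set E₁ := E.pullback (AlgPoints.mapContinuous g) with hE₁
  -- trivialisations at points of `X`, local isomorphisms over their preimages
  choose Uof eof hmem using hF
  have hloc := fun (U : X.left.Opens) (e : SheafOfModules.free (Fin r) ≅ F.over U) ↦
    exists_local_iso_pullback_of_comparison g E E' α β hcont hframe hcont' hframe' e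
  choose iOf hiOf using hloc
  have hfrX : ∀ (U : X.left.Opens) (e : SheafOfModules.free (Fin r) ≅ F.over U),
      IsSectionFrame F U (fun k ↦ basisSection e k) := fun U e ↦
    isSectionFrame_basisSection e (Equiv.refl _)
  -- the glued fibrewise equivalences (trivialisation chosen at `g(Q.pt)`)
  have hQU : ∀ Q : ComplexPoints Y, Q.pt ∉ (((g.left ⁻¹ᵁ Uof (g.left.base Q.pt) : Y.left.Opens) : Set Y.left)ᶜ) :=
    fun Q ↦ Set.notMem_compl_iff.2 (hmem (g.left.base Q.pt))
  let φ : ∀ Q : ComplexPoints Y, E₁.E Q ≃L[ℂ] E'.E Q := fun Q ↦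
    (iOf (Uof (g.left.base Q.pt)) (eof (g.left.base Q.pt))).equiv ⟨Q, hQU Q⟩
  have hgQ : ∀ Q : ComplexPoints Y, (AlgPoints.map g Q).pt ∈ Uof (g.left.base Q.pt) := fun Q ↦ hmem _
  -- `φ` matches `α` and `α' ∘ η` on every section
  have hφ : ∀ (U : X.left.Opens) (σ : Γ(F, U)) (Q : ComplexPoints Y), (AlgPoints.map g Q).pt ∈ U →
      φ Q (α U σ (AlgPoints.map g Q)) = β (g.left ⁻¹ᵁ U) (unitSection g.left F U σ) Q := by
    intro U σ Q hQ
    letI : ∀ P : ComplexPoints X, AddCommGroup (E.E P) := fun P ↦ Module.addCommMonoidToAddCommGroup ℂ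
    letI : ∀ Q : ComplexPoints Y, AddCommGroup (E'.E Q) := fun Q ↦ Module.addCommMonoidToAddCommGroup ℂ
    exact comparison_pullback_eq_of_frame g α β hadd hsmul hres hadd' hsmul' hres' (hfrX _ _) (hgQ Q)
      ((φ Q : E₁.E Q →L[ℂ] E'.E Q) :
        E₁.E Q →ₗ[ℂ] E'.E Q)
      (fun k ↦ hiOf _ _ ⟨Q, hQU Q⟩ k) σ hQ
  -- independence of the trivialisation: `φ` agrees with every local isomorphism
  have hind : ∀ (U : X.left.Opens) (e : SheafOfModules.free (Fin r) ≅ F.over U) (Q : ComplexPoints Y)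
      (hQ : Q.pt ∉ (((g.left ⁻¹ᵁ U : Y.left.Opens) : Set Y.left)ᶜ)) (v : E₁.E Q),
      φ Q v = (iOf U e).equiv ⟨Q, hQ⟩ v := by
    intro U e Q hQ v
    let ψ : E₁.E Q ≃L[ℂ] E'.E Q := (iOf U e).equiv ⟨Q, hQ⟩
    have key := linearMap_eq_of_comparison_pullback g α β hadd hsmul hres hframe hadd' hsmul' hres'
      (hfrX _ (eof (g.left.base Q.pt))) (hfrX U e) (hgQ Q) (Set.notMem_compl_iff.1 hQ)
      ((φ Q : E₁.E Q →L[ℂ] E'.E Q) :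
        E₁.E Q →ₗ[ℂ] E'.E Q)
      ((ψ : E₁.E Q →L[ℂ] E'.E Q) :
        E₁.E Q →ₗ[ℂ] E'.E Q)
      (fun k ↦ hiOf _ _ ⟨Q, hQU Q⟩ k) (fun k ↦ hiOf U e ⟨Q, hQ⟩ k)
    exact congrArg (fun f : E₁.E Q →ₗ[ℂ] E'.E Q ↦ f v) key
  have hind' : ∀ (U : X.left.Opens) (e : SheafOfModules.free (Fin r) ≅ F.over U) (Q : ComplexPoints Y)
      (hQ : Q.pt ∉ (((g.left ⁻¹ᵁ U : Y.left.Opens) : Set Y.left)ᶜ)) (w : E'.E Q),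
      (φ Q).symm w = ((iOf U e).equiv ⟨Q, hQ⟩).symm w := by
    intro U e Q hQ w
    apply (φ Q).injective
    rw [ContinuousLinearEquiv.apply_symm_apply, hind U e Q hQ]
    exact (((iOf U e).equiv ⟨Q, hQ⟩).apply_symm_apply w).symm
  -- continuity is local
  have hopen : ∀ U : X.left.Opens, IsOpen {q : TotalSpace E₁.F E₁.E | q.proj.pt ∈ g.left ⁻¹ᵁ U} := fun U ↦
    (AlgPoints.isOpen_setOf_pt_mem (g.left ⁻¹ᵁ U)).preimage (FiberBundle.continuous_proj E₁.F E₁.E)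
  have hopen' : ∀ U : X.left.Opens, IsOpen {q : TotalSpace E'.F E'.E | q.proj.pt ∈ g.left ⁻¹ᵁ U} := fun U ↦
    (AlgPoints.isOpen_setOf_pt_mem (g.left ⁻¹ᵁ U)).preimage (FiberBundle.continuous_proj E'.F E'.E)
  refine ⟨{ equiv := φ, continuous_toFun := ?_, continuous_invFun := ?_ }, hφ⟩
  · refine continuous_iff_continuousAt.2 fun q₀ ↦ ?_
    obtain ⟨x₀, hx₀⟩ : ∃ x₀ : X.left, g.left.base q₀.proj.pt = x₀ := ⟨_, rfl⟩
    have hq₀ : q₀ ∈ {q : TotalSpace E₁.F E₁.E | q.proj.pt ∈ g.left ⁻¹ᵁ Uof x₀} := by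
      change g.left.base q₀.proj.pt ∈ Uof x₀
      rw [hx₀]
      exact hmem x₀
    refine ContinuousOn.continuousAt ?_ ((hopen (Uof x₀)).mem_nhds hq₀)
    rw [continuousOn_iff_continuous_restrict]
    let j : {q : TotalSpace E₁.F E₁.E | q.proj.pt ∈ g.left ⁻¹ᵁ (Uof x₀)} →
        TotalSpace (E₁.pullback (⟨Subtype.val, continuous_subtype_val⟩ :
          C(complexPointsCompl Y (((g.left ⁻¹ᵁ (Uof x₀) : Y.left.Opens) : Set Y.left)ᶜ), ComplexPoints Y))).F
          (E₁.pullback (⟨Subtype.val, continuous_subtype_val⟩ :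
          C(complexPointsCompl Y (((g.left ⁻¹ᵁ (Uof x₀) : Y.left.Opens) : Set Y.left)ᶜ), ComplexPoints Y))).E :=
      fun q ↦ ⟨⟨q.1.proj, Set.notMem_compl_iff.2 q.2⟩, q.1.2⟩
    have hj : Continuous j :=
      (inducing_pullbackTotalSpaceEmbedding E₁.F E₁.E
        (⟨Subtype.val, continuous_subtype_val⟩ :
          C(complexPointsCompl Y (((g.left ⁻¹ᵁ (Uof x₀) : Y.left.Opens) : Set Y.left)ᶜ), ComplexPoints Y))).continuous_iff.2
        ((Continuous.subtype_mk ((FiberBundle.continuous_proj E₁.F E₁.E).comp continuous_subtype_val) _).prodMk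
          continuous_subtype_val)
    have hcomp : Continuous ((Pullback.lift (⟨Subtype.val, continuous_subtype_val⟩ :
          C(complexPointsCompl Y (((g.left ⁻¹ᵁ (Uof x₀) : Y.left.Opens) : Set Y.left)ᶜ), ComplexPoints Y)) :
          TotalSpace E'.F ((⟨Subtype.val, continuous_subtype_val⟩ :
            C(complexPointsCompl Y (((g.left ⁻¹ᵁ (Uof x₀) : Y.left.Opens) : Set Y.left)ᶜ), ComplexPoints Y)) *ᵖ E'.E) →
          TotalSpace E'.F E'.E) ∘
        (fun p : TotalSpace (E₁.pullback (⟨Subtype.val, continuous_subtype_val⟩ :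
            C(complexPointsCompl Y (((g.left ⁻¹ᵁ (Uof x₀) : Y.left.Opens) : Set Y.left)ᶜ), ComplexPoints Y))).F
            (E₁.pullback (⟨Subtype.val, continuous_subtype_val⟩ :
            C(complexPointsCompl Y (((g.left ⁻¹ᵁ (Uof x₀) : Y.left.Opens) : Set Y.left)ᶜ), ComplexPoints Y))).E ↦
          (⟨p.proj, (iOf (Uof x₀) (eof x₀)).equiv p.proj p.2⟩ :
            TotalSpace (E'.pullback (⟨Subtype.val, continuous_subtype_val⟩ :
              C(complexPointsCompl Y (((g.left ⁻¹ᵁ (Uof x₀) : Y.left.Opens) : Set Y.left)ᶜ), ComplexPoints Y))).F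
              (E'.pullback (⟨Subtype.val, continuous_subtype_val⟩ :
              C(complexPointsCompl Y (((g.left ⁻¹ᵁ (Uof x₀) : Y.left.Opens) : Set Y.left)ᶜ), ComplexPoints Y))).E)) ∘ j) :=
      (Pullback.continuous_lift E'.F E'.E _).comp ((iOf (Uof x₀) (eof x₀)).continuous_toFun.comp hj)
    refine hcomp.congr fun q ↦ ?_
    change (⟨q.1.proj, (iOf (Uof x₀) (eof x₀)).equiv ⟨q.1.proj, _⟩ q.1.2⟩ : TotalSpace E'.F E'.E) = ⟨q.1.proj, φ q.1.proj q.1.2⟩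
    rw [hind (Uof x₀) (eof x₀) q.1.proj (Set.notMem_compl_iff.2 q.2)]
  · refine continuous_iff_continuousAt.2 fun q₀ ↦ ?_
    obtain ⟨x₀, hx₀⟩ : ∃ x₀ : X.left, g.left.base q₀.proj.pt = x₀ := ⟨_, rfl⟩
    have hq₀ : q₀ ∈ {q : TotalSpace E'.F E'.E | q.proj.pt ∈ g.left ⁻¹ᵁ Uof x₀} := by
      change g.left.base q₀.proj.pt ∈ Uof x₀
      rw [hx₀]
      exact hmem x₀
    refine ContinuousOn.continuousAt ?_ ((hopen' (Uof x₀)).mem_nhds hq₀)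
    rw [continuousOn_iff_continuous_restrict]
    let j : {q : TotalSpace E'.F E'.E | q.proj.pt ∈ g.left ⁻¹ᵁ (Uof x₀)} →
        TotalSpace (E'.pullback (⟨Subtype.val, continuous_subtype_val⟩ :
          C(complexPointsCompl Y (((g.left ⁻¹ᵁ (Uof x₀) : Y.left.Opens) : Set Y.left)ᶜ), ComplexPoints Y))).F
          (E'.pullback (⟨Subtype.val, continuous_subtype_val⟩ :
          C(complexPointsCompl Y (((g.left ⁻¹ᵁ (Uof x₀) : Y.left.Opens) : Set Y.left)ᶜ), ComplexPoints Y))).E :=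
      fun q ↦ ⟨⟨q.1.proj, Set.notMem_compl_iff.2 q.2⟩, q.1.2⟩
    have hj : Continuous j :=
      (inducing_pullbackTotalSpaceEmbedding E'.F E'.E
        (⟨Subtype.val, continuous_subtype_val⟩ :
          C(complexPointsCompl Y (((g.left ⁻¹ᵁ (Uof x₀) : Y.left.Opens) : Set Y.left)ᶜ), ComplexPoints Y))).continuous_iff.2
        ((Continuous.subtype_mk ((FiberBundle.continuous_proj E'.F E'.E).comp continuous_subtype_val) _).prodMk
          continuous_subtype_val)
    have hcomp : Continuous ((Pullback.lift (⟨Subtype.val, continuous_subtype_val⟩ :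
          C(complexPointsCompl Y (((g.left ⁻¹ᵁ (Uof x₀) : Y.left.Opens) : Set Y.left)ᶜ), ComplexPoints Y)) :
          TotalSpace E₁.F ((⟨Subtype.val, continuous_subtype_val⟩ :
            C(complexPointsCompl Y (((g.left ⁻¹ᵁ (Uof x₀) : Y.left.Opens) : Set Y.left)ᶜ), ComplexPoints Y)) *ᵖ E₁.E) →
          TotalSpace E₁.F E₁.E) ∘
        (fun p : TotalSpace (E'.pullback (⟨Subtype.val, continuous_subtype_val⟩ :
            C(complexPointsCompl Y (((g.left ⁻¹ᵁ (Uof x₀) : Y.left.Opens) : Set Y.left)ᶜ), ComplexPoints Y))).F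
            (E'.pullback (⟨Subtype.val, continuous_subtype_val⟩ :
            C(complexPointsCompl Y (((g.left ⁻¹ᵁ (Uof x₀) : Y.left.Opens) : Set Y.left)ᶜ), ComplexPoints Y))).E ↦
          (⟨p.proj, ((iOf (Uof x₀) (eof x₀)).equiv p.proj).symm p.2⟩ :
            TotalSpace (E₁.pullback (⟨Subtype.val, continuous_subtype_val⟩ :
              C(complexPointsCompl Y (((g.left ⁻¹ᵁ (Uof x₀) : Y.left.Opens) : Set Y.left)ᶜ), ComplexPoints Y))).F
              (E₁.pullback (⟨Subtype.val, continuous_subtype_val⟩ :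
              C(complexPointsCompl Y (((g.left ⁻¹ᵁ (Uof x₀) : Y.left.Opens) : Set Y.left)ᶜ), ComplexPoints Y))).E)) ∘ j) :=
      (Pullback.continuous_lift E₁.F E₁.E _).comp ((iOf (Uof x₀) (eof x₀)).continuous_invFun.comp hj)
    refine hcomp.congr fun q ↦ ?_
    change (⟨q.1.proj, ((iOf (Uof x₀) (eof x₀)).equiv ⟨q.1.proj, _⟩).symm q.1.2⟩ : TotalSpace E₁.F E₁.E) =
      ⟨q.1.proj, (φ q.1.proj).symm q.1.2⟩
    rw [hind' (Uof x₀) (eof x₀) q.1.proj (Set.notMem_compl_iff.2 q.2)]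


end Summit.HodgeConjecture.HodgeConjecture.Theorems


end
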